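import Mathlib

/-!
# Subfield cell: the `q`-Frobenius on `SL₂(K)`, the subfield copy `SL₂(k) ≤ SL₂(K)` as its fixed
# points, and the normaliser bound (F0) `|N(SL₂(k))| ≤ 2·|SL₂(k)|`

Unit `b2b-lgcu-subfield` (gen 20), supporting `stmt-MatrixMultiplication-7610` (registered stub
`stub_subfieldCell`, S3).  This is the first file of the BGT-free plan (SUBFIELD.md §25,
`BGTFreePlan.lean`): for finite fields `k`, `K` with a ring map `ι : k →+* K` and
`|K| = |k|²` we set up

* `σ : K →+* K`, `x ↦ x ^ |k|` — a ring involution of `K` whose fixed points are exactly `ι(k)`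
  (`frob_apply_eq_self_iff`);
* `S₀[ι] = SL₂(ι k) ≤ SL₂(K)` (the range of `Matrix.SpecialLinearGroup.map ι`) and the
  characterisation `h ∈ S₀[ι] ↔ map (σ) h = h` (`mem_subfieldSL_iff`);
* the normaliser test: `g` normalises `S₀[ι]` iff `map (σ) g = g ∨ map (σ) g = -g`
  (`frobSL_eq_or_eq_neg_of_mem_normalizer`, `mem_normalizer_of_frobSL`), via "a matrix commuting
  with both elementary unipotents is scalar";
* **(F0)** `Nat.card (normalizer) ≤ 2 * Fintype.card (SL₂ k)` (`subfieldCell_normalizer_card_le`),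
  in exactly the shape of `BGTFreePlan.F0`.

HONEST FRAMING: finite-group lemmas toward an unconditional `¬ stub_subfieldCell`;
NOT summit progress.
-/

set_option linter.dupNamespace false

namespace Summit.MatrixMultiplication.MatrixMultiplication.Theorems.GradedDesignFamily.Negative

open scoped Pointwise MatrixGroups
open Polynomial

/-- `S₀[ι]`: the subfield copy `SL₂(ι k) ≤ SL₂(K)` (range of `Matrix.SpecialLinearGroup.map ι`). -/
local notation "S₀[" ι "]" => MonoidHom.range (Matrix.SpecialLinearGroup.map (n := Fin 2) ι)
/-- `N[ι]`: the normaliser of `S₀[ι]` in `SL₂(K)`. -/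
local notation "N[" ι "]" => Subgroup.normalizer
  (SetLike.coe (MonoidHom.range (Matrix.SpecialLinearGroup.map (n := Fin 2) ι)))
/-- `Fr[σ]`: the endomorphism of `SL₂(K)` induced by a ring endomorphism `σ` of `K`. -/
local notation "Fr[" σ "]" => Matrix.SpecialLinearGroup.map (n := Fin 2) σ

variable {k K : Type} [Field k] [Fintype k] [DecidableEq k] [Field K] [Fintype K] [DecidableEq K]

/-! ## The `q`-Frobenius of `K`, `q = |k|` -/

omit [DecidableEq k] [Fintype K] [DecidableEq K] in
/-- `(x + y) ^ |k| = x ^ |k| + y ^ |k|` in `K` (the characteristics of `k` and `K` agree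
via `ι`). -/
theorem subfieldCell_add_pow_card (ι : k →+* K) (x y : K) :
    (x + y) ^ Fintype.card k = x ^ Fintype.card k + y ^ Fintype.card k := by
  obtain ⟨p, hchar, n, hp, hk⟩ := FiniteField.card' k
  haveI := hchar
  haveI : Fact p.Prime := ⟨hp⟩
  haveI : CharP K p := (ι.charP_iff_charP p).mp hchar
  rw [hk]
  exact add_pow_char_pow x y p n

omit [DecidableEq k] [Fintype K] [DecidableEq K] in
/-- A ring endomorphism `σ` of `K` agreeing with `x ↦ x ^ |k|` exists (`char K = char k`
via `ι`). -/
theorem exists_frobenius (ι : k →+* K) : ∃ σ : K →+* K, ∀ x, σ x = x ^ Fintype.card k :=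
  ⟨{ toFun := fun x => x ^ Fintype.card k
     map_one' := one_pow _
     map_mul' := fun x y => mul_pow x y _
     map_zero' := zero_pow Fintype.card_ne_zero
     map_add' := subfieldCell_add_pow_card ι }, fun _ => rfl⟩

omit [DecidableEq k] [Fintype K] [DecidableEq K] in
/-- `σ` fixes `ι(k)` pointwise. -/
theorem frob_apply_ι (ι : k →+* K)
    (σ : K →+* K) (hσ : ∀ x, σ x = x ^ Fintype.card k) (a : k) : σ (ι a) = ι a := by
  rw [hσ, ← map_pow, FiniteField.pow_card]

omit [Field k] [DecidableEq k] [DecidableEq K] in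
/-- `frob` is an involution when `|K| = |k|²`. -/
theorem frob_frob (σ : K →+* K) (hσ : ∀ x, σ x = x ^ Fintype.card k)
    (hK : Fintype.card K = Fintype.card k ^ 2) (x : K) :
    σ (σ x) = x := by
  rw [hσ, hσ, ← pow_mul, ← sq, ← hK, FiniteField.pow_card]

omit [Field k] [DecidableEq k] [DecidableEq K] in
/-- `σ` is injective (it is an involution). -/
theorem frob_injective (σ : K →+* K) (hσ : ∀ x, σ x = x ^ Fintype.card k)
    (hK : Fintype.card K = Fintype.card k ^ 2) :
    Function.Injective (σ) := fun x y h => by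
  rw [← frob_frob σ hσ hK x, ← frob_frob σ hσ hK y, h]

omit [DecidableEq k] in
/-- The fixed points of `σ` are exactly `ι(k)` (root count of `X ^ q - X`). -/
theorem frob_apply_eq_self_iff (ι : k →+* K)
    (σ : K →+* K) (hσ : ∀ x, σ x = x ^ Fintype.card k) (x : K) :
    σ x = x ↔ x ∈ Set.range ι := by
  constructor
  · intro hx
    -- the fixed set has at most `q` elements and contains the `q` elements of `ι(k)`
    set q := Fintype.card k with hq
    have hq1 : 1 < q := Fintype.one_lt_card
    set Fix : Finset K := Finset.univ.filter fun y : K => y ^ q = y with hFix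
    have hsub : Finset.univ.image ι ⊆ Fix := by
      intro y hy
      obtain ⟨a, -, rfl⟩ := Finset.mem_image.mp hy
      simp only [hFix, Finset.mem_filter, Finset.mem_univ, true_and]
      rw [← map_pow, FiniteField.pow_card]
    have hcardFix : Fix.card ≤ q := by
      have hne : (X ^ q - X : K[X]) ≠ 0 := FiniteField.X_pow_card_sub_X_ne_zero K hq1
      have hsub' : Fix ⊆ (X ^ q - X : K[X]).roots.toFinset := by
        intro y hy
        simp only [hFix, Finset.mem_filter, Finset.mem_univ, true_and] at hy
        rw [Multiset.mem_toFinset, Polynomial.mem_roots hne]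
        simp [hy]
      calc Fix.card ≤ (X ^ q - X : K[X]).roots.toFinset.card := Finset.card_le_card hsub'
        _ ≤ (X ^ q - X : K[X]).roots.card := Multiset.toFinset_card_le _
        _ ≤ (X ^ q - X : K[X]).natDegree := Polynomial.card_roots' _
        _ = q := FiniteField.X_pow_card_sub_X_natDegree_eq K hq1
    have hcardIm : (Finset.univ.image ι).card = q := by
      rw [Finset.card_image_of_injective _ ι.injective, Finset.card_univ]
    have hEq : Finset.univ.image ι = Fix :=
      Finset.eq_of_subset_of_card_le hsub (by rw [hcardIm]; exact hcardFix)
    have hxFix : x ∈ Fix := by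
      simp only [hFix, Finset.mem_filter, Finset.mem_univ, true_and]
      rw [← hσ]; exact hx
    rw [← hEq] at hxFix
    obtain ⟨a, -, ha⟩ := Finset.mem_image.mp hxFix
    exact ⟨a, ha⟩
  · rintro ⟨a, rfl⟩
    exact frob_apply_ι ι σ hσ a

/-! ## The subfield copy `SL₂(ι k)` and its Frobenius characterisation -/

/-! Notation used informally below: `S₀ = S₀[ι]` (the subfield
copy `SL₂(ι k)`), `N(S₀)` its normaliser in `SL₂(K)`, and `σ` any ring endomorphism of `K` agreeing
with `x ↦ x ^ |k|` (it exists: `exists_frobenius`). -/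

omit [DecidableEq k] [Fintype K] [DecidableEq K] in
/-- Entries of `Fr[σ] g` are the `q`-th powers of the entries of `g`. -/
theorem frobSL_apply_coe (σ : K →+* K) (g : SL(2, K)) (i j : Fin 2) :
    (Fr[σ] g : Matrix (Fin 2) (Fin 2) K) i j = σ ((g : Matrix (Fin 2) (Fin 2) K) i j) := by
  simp [Matrix.SpecialLinearGroup.map]

omit [Field k] [DecidableEq k] [DecidableEq K] in
/-- `Fr[σ]` is an involution when `|K| = |k|²`. -/
theorem frobSL_frobSL (σ : K →+* K) (hσ : ∀ x, σ x = x ^ Fintype.card k)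
    (hK : Fintype.card K = Fintype.card k ^ 2)
    (g : SL(2, K)) : Fr[σ] (Fr[σ] g) = g := by
  ext i j
  rw [frobSL_apply_coe, frobSL_apply_coe, frob_frob σ hσ hK]

omit [DecidableEq k] [Fintype K] [DecidableEq K] in
/-- `Fr[σ]` fixes the image of `SL₂(k)`. -/
theorem frobSL_map (ι : k →+* K)
    (σ : K →+* K) (hσ : ∀ x, σ x = x ^ Fintype.card k) (a : SL(2, k)) :
    Fr[σ] (Matrix.SpecialLinearGroup.map ι a) = Matrix.SpecialLinearGroup.map ι a := by
  ext i j
  rw [frobSL_apply_coe]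
  simp [Matrix.SpecialLinearGroup.map, frob_apply_ι ι σ hσ]

omit [DecidableEq k] [Fintype K] [DecidableEq K] in
/-- Elements of `S₀` are fixed by `Fr[σ]`. -/
theorem frobSL_eq_self_of_mem (ι : k →+* K)
    (σ : K →+* K) (hσ : ∀ x, σ x = x ^ Fintype.card k) {h : SL(2, K)}
    (hh : h ∈ S₀[ι]) : Fr[σ] h = h := by
  obtain ⟨a, rfl⟩ := hh
  exact frobSL_map ι σ hσ a

omit [DecidableEq k] in
/-- Fixed points of `Fr[σ]` lie in `S₀`. -/
theorem mem_subfieldSL_of_frobSL_eq (ι : k →+* K)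
    (σ : K →+* K) (hσ : ∀ x, σ x = x ^ Fintype.card k) {h : SL(2, K)}
    (hh : Fr[σ] h = h) : h ∈ S₀[ι] := by
  -- every entry of `h` is fixed by `σ`, hence lies in `ι(k)`
  have hent : ∀ i j, ∃ a : k, ι a = (h : Matrix (Fin 2) (Fin 2) K) i j := by
    intro i j
    have hij : σ ((h : Matrix (Fin 2) (Fin 2) K) i j) = (h : Matrix (Fin 2) (Fin 2) K) i j := by
      rw [← frobSL_apply_coe, hh]
    exact (frob_apply_eq_self_iff ι σ hσ _).mp hij
  choose a ha using hent
  have hA : ι.mapMatrix (Matrix.of fun i j => a i j) = (h : Matrix (Fin 2) (Fin 2) K) := by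
    ext i j
    simp [ha]
  have hdet : Matrix.det (Matrix.of fun i j => a i j) = 1 := by
    apply ι.injective
    rw [RingHom.map_det, hA, map_one, Matrix.SpecialLinearGroup.det_coe]
  refine ⟨⟨Matrix.of fun i j => a i j, hdet⟩, ?_⟩
  ext i j
  simp [Matrix.SpecialLinearGroup.map, ha]

omit [DecidableEq k] in
/-- `S₀ = SL₂(ι k)` is exactly the fixed subgroup of the Frobenius. -/
theorem mem_subfieldSL_iff (ι : k →+* K)
    (σ : K →+* K) (hσ : ∀ x, σ x = x ^ Fintype.card k) (h : SL(2, K)) :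
    h ∈ S₀[ι] ↔ Fr[σ] h = h :=
  ⟨frobSL_eq_self_of_mem ι σ hσ, mem_subfieldSL_of_frobSL_eq ι σ hσ⟩

/-! ## The normaliser test -/

omit [Fintype k] [DecidableEq k] [Fintype K] [DecidableEq K] in
/-- The two elementary unipotents lie in `S₀`. -/
theorem upperUnipotent_mem_subfieldSL (ι : k →+* K) :
    (⟨!![1, 1; 0, 1], by simp [Matrix.det_fin_two_of]⟩ : SL(2, K)) ∈
      S₀[ι] := by
  refine ⟨⟨!![1, 1; 0, 1], by simp [Matrix.det_fin_two_of]⟩, ?_⟩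
  ext i j
  fin_cases i <;> fin_cases j <;> simp [Matrix.SpecialLinearGroup.map]

omit [Fintype k] [DecidableEq k] [Fintype K] [DecidableEq K] in
/-- The lower elementary unipotent lies in `S₀`. -/
theorem lowerUnipotentOne_mem_subfieldSL (ι : k →+* K) :
    (⟨!![1, 0; 1, 1], by simp [Matrix.det_fin_two_of]⟩ : SL(2, K)) ∈
      S₀[ι] := by
  refine ⟨⟨!![1, 0; 1, 1], by simp [Matrix.det_fin_two_of]⟩, ?_⟩
  ext i j
  fin_cases i <;> fin_cases j <;> simp [Matrix.SpecialLinearGroup.map]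

/-- A `2 × 2` matrix commuting with both elementary unipotents is scalar. -/
theorem eq_scalar_of_commute_unipotents {R : Type} [CommRing R] (m : Matrix (Fin 2) (Fin 2) R)
    (hE : m * !![1, 1; 0, 1] = !![1, 1; 0, 1] * m) (hF : m * !![1, 0; 1, 1] = !![1, 0; 1, 1] * m) :
    m = m 0 0 • (1 : Matrix (Fin 2) (Fin 2) R) := by
  have h00 := congrFun (congrFun hE 0) 0
  have h01 := congrFun (congrFun hE 0) 1
  have h00' := congrFun (congrFun hF 0) 0
  simp [Matrix.mul_apply, Fin.sum_univ_two] at h00 h01 h00'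
  have h11 : m 1 1 = m 0 0 := by linear_combination -h01
  ext i j
  fin_cases i <;> fin_cases j <;> simp [h00, h00', h11]

omit [Fintype K] [DecidableEq K] in
/-- In `SL₂(K)` (with `HasDistribNeg`), `(-g)⁻¹ = -g⁻¹`. -/
theorem subfieldCell_neg_inv (g : SL(2, K)) : (-g)⁻¹ = -g⁻¹ := by
  rw [inv_eq_iff_mul_eq_one]
  simp

omit [DecidableEq k] [Fintype K] [DecidableEq K] in
/-- If `g` normalises `S₀` then `frob g = g` or `frob g = -g`. -/
theorem frobSL_eq_or_eq_neg_of_mem_normalizer (ι : k →+* K)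
    (σ : K →+* K) (hσ : ∀ x, σ x = x ^ Fintype.card k)
    {g : SL(2, K)} (hg : g ∈ N[ι]) :
    Fr[σ] g = g ∨ Fr[σ] g = -g := by
  -- `m := g⁻¹ * frob g` centralises `S₀`
  have key : ∀ h ∈ S₀[ι], g⁻¹ * Fr[σ] g * h = h * (g⁻¹ * Fr[σ] g) := by
    intro h hh
    have h1 : g * h * g⁻¹ ∈ S₀[ι] := (Subgroup.mem_normalizer_iff.mp hg h).mp hh
    have h2 : Fr[σ] (g * h * g⁻¹) = g * h * g⁻¹ := frobSL_eq_self_of_mem ι σ hσ h1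
    rw [map_mul, map_mul, map_inv, frobSL_eq_self_of_mem ι σ hσ hh] at h2
    -- h2 : frob g * h * (frob g)⁻¹ = g * h * g⁻¹
    have h3 : g⁻¹ * (Fr[σ] g * h * (Fr[σ] g)⁻¹) * Fr[σ] g =
        g⁻¹ * (g * h * g⁻¹) * Fr[σ] g := by rw [h2]
    have lhs : g⁻¹ * (Fr[σ] g * h * (Fr[σ] g)⁻¹) * Fr[σ] g = g⁻¹ * Fr[σ] g * h := by
      group
    have rhs : g⁻¹ * (g * h * g⁻¹) * Fr[σ] g = h * (g⁻¹ * Fr[σ] g) := by group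
    rw [lhs, rhs] at h3
    exact h3
  set m := g⁻¹ * Fr[σ] g with hm
  have hE := key _ (upperUnipotent_mem_subfieldSL ι)
  have hF := key _ (lowerUnipotentOne_mem_subfieldSL ι)
  have hEm : (m : Matrix (Fin 2) (Fin 2) K) * !![1, 1; 0, 1] =
      !![1, 1; 0, 1] * (m : Matrix (Fin 2) (Fin 2) K) := by
    have := congrArg (fun x : SL(2, K) => (x : Matrix (Fin 2) (Fin 2) K)) hE
    simpa using this
  have hFm : (m : Matrix (Fin 2) (Fin 2) K) * !![1, 0; 1, 1] =
      !![1, 0; 1, 1] * (m : Matrix (Fin 2) (Fin 2) K) := by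
    have := congrArg (fun x : SL(2, K) => (x : Matrix (Fin 2) (Fin 2) K)) hF
    simpa using this
  have hscal := eq_scalar_of_commute_unipotents (m : Matrix (Fin 2) (Fin 2) K) hEm hFm
  set c : K := (m : Matrix (Fin 2) (Fin 2) K) 0 0 with hc
  have hdet : c ^ 2 = 1 := by
    have h1 : Matrix.det (m : Matrix (Fin 2) (Fin 2) K) = 1 := m.det_coe
    rw [hscal, Matrix.det_smul, Matrix.det_one, mul_one, Fintype.card_fin] at h1
    exact h1
  have hc1 : c = 1 ∨ c = -1 := by
    have h0 : (c - 1) * (c + 1) = 0 := by linear_combination hdet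
    rcases mul_eq_zero.mp h0 with h | h
    · left; linear_combination h
    · right; linear_combination h
  have hmval : m = 1 ∨ m = -1 := by
    rcases hc1 with h | h
    · left
      ext i j
      rw [hscal, h]
      simp
    · right
      ext i j
      rw [hscal, h]
      fin_cases i <;> fin_cases j <;> simp
  rcases hmval with h | h
  · left
    have : Fr[σ] g = g * m := by rw [hm]; group
    rw [this, h, mul_one]
  · right
    have : Fr[σ] g = g * m := by rw [hm]; group
    rw [this, h, mul_neg, mul_one]

omit [DecidableEq k] in
/-- Conversely, `frob g = ± g` implies that `g` normalises `S₀`. -/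
theorem mem_normalizer_of_frobSL (ι : k →+* K)
    (σ : K →+* K) (hσ : ∀ x, σ x = x ^ Fintype.card k) {g : SL(2, K)}
    (hg : Fr[σ] g = g ∨ Fr[σ] g = -g) : g ∈ N[ι] := by
  rw [Subgroup.mem_normalizer_iff]
  intro h
  constructor
  · intro hh
    apply mem_subfieldSL_of_frobSL_eq ι σ hσ
    rw [map_mul, map_mul, map_inv, frobSL_eq_self_of_mem ι σ hσ hh]
    rcases hg with e | e <;> rw [e]
    rw [subfieldCell_neg_inv, neg_mul, neg_mul, mul_neg, neg_neg]
  · intro hh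
    apply mem_subfieldSL_of_frobSL_eq ι σ hσ
    have e1 : h = g⁻¹ * (g * h * g⁻¹) * g := by group
    rw [e1, map_mul, map_mul, map_inv, frobSL_eq_self_of_mem ι σ hσ hh]
    rcases hg with e | e <;> rw [e]
    rw [subfieldCell_neg_inv, neg_mul, neg_mul, mul_neg, neg_neg]

omit [DecidableEq k] in
/-- The normaliser test: `g ∈ N(S₀) ↔ frob g = ±g`. -/
theorem mem_subfieldSLNormalizer_iff (ι : k →+* K)
    (σ : K →+* K) (hσ : ∀ x, σ x = x ^ Fintype.card k) (g : SL(2, K)) :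
    g ∈ N[ι] ↔ (Fr[σ] g = g ∨ Fr[σ] g = -g) :=
  ⟨frobSL_eq_or_eq_neg_of_mem_normalizer ι σ hσ, mem_normalizer_of_frobSL ι σ hσ⟩

/-! ## (F0): the normaliser has at most `2·|SL₂(k)|` elements -/

/-- At most `|SL₂(k)|` elements of `SL₂(K)` are fixed by `Fr[σ]`. -/
theorem card_filter_frobSL_eq_le (ι : k →+* K)
    (σ : K →+* K) (hσ : ∀ x, σ x = x ^ Fintype.card k) :
    (Finset.univ.filter fun g : SL(2, K) => Fr[σ] g = g).card ≤
      Fintype.card (SL(2, k)) := by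
  have hsub : (Finset.univ.filter fun g : SL(2, K) => Fr[σ] g = g) ⊆
      Finset.univ.image (Matrix.SpecialLinearGroup.map ι) := by
    intro g hg
    simp only [Finset.mem_filter, Finset.mem_univ, true_and] at hg
    obtain ⟨a, ha⟩ := mem_subfieldSL_of_frobSL_eq ι σ hσ hg
    exact Finset.mem_image.mpr ⟨a, Finset.mem_univ _, ha⟩
  calc _ ≤ (Finset.univ.image (Matrix.SpecialLinearGroup.map ι
            (n := Fin 2) (R := k) (S := K))).card := Finset.card_le_card hsub
    _ ≤ Finset.univ.card := Finset.card_image_le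
    _ = _ := Finset.card_univ

/-- At most `|SL₂(k)|` elements of `SL₂(K)` are negated by `Fr[σ]` (they form one coset of the
fixed subgroup, or none). -/
theorem card_filter_frobSL_eq_neg_le (ι : k →+* K)
    (σ : K →+* K) (hσ : ∀ x, σ x = x ^ Fintype.card k) :
    (Finset.univ.filter fun g : SL(2, K) => Fr[σ] g = -g).card ≤
      Fintype.card (SL(2, k)) := by
  set B := Finset.univ.filter fun g : SL(2, K) => Fr[σ] g = -g
    with hB
  rcases B.eq_empty_or_nonempty with hBe | ⟨g₁, hg₁⟩
  · rw [hBe]; simp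
  · have hg₁' : Fr[σ] g₁ = -g₁ := by
      simp only [hB, Finset.mem_filter, Finset.mem_univ, true_and] at hg₁; exact hg₁
    have hsub : B ⊆ (Finset.univ.filter fun g : SL(2, K) =>
        Fr[σ] g = g).image (g₁ * ·) := by
      intro g hg
      simp only [hB, Finset.mem_filter, Finset.mem_univ, true_and] at hg
      refine Finset.mem_image.mpr ⟨g₁⁻¹ * g, ?_, by group⟩
      simp only [Finset.mem_filter, Finset.mem_univ, true_and]
      rw [map_mul, map_inv, hg, hg₁', subfieldCell_neg_inv, neg_mul, mul_neg, neg_neg]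
    calc B.card ≤ _ := Finset.card_le_card hsub
      _ ≤ _ := Finset.card_image_le
      _ ≤ _ := card_filter_frobSL_eq_le ι σ hσ

/-- **(F0)** `|N_{SL₂(K)}(SL₂(ι k))| ≤ 2·|SL₂(k)|` — in exactly the shape of `BGTFreePlan.F0`
(the hypothesis `|K| = |k|²` is not even needed for the bound). -/
theorem subfieldCell_normalizer_card_le (k K : Type) [Field k] [Fintype k] [DecidableEq k]
    [Field K] [Fintype K] [DecidableEq K] (ι : k →+* K)
    (_hK : Fintype.card K = Fintype.card k ^ 2) :
    Nat.card (N[ι]) ≤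
      2 * Fintype.card (SL(2, k)) := by
  classical
  obtain ⟨σ, hσ⟩ := exists_frobenius ι
  set P : SL(2, K) → Prop := fun g => Fr[σ] g = g ∨ Fr[σ] g = -g
    with hP
  have hinj : Function.Injective (fun g : N[ι] =>
      (⟨(g : SL(2, K)), frobSL_eq_or_eq_neg_of_mem_normalizer ι σ hσ g.2⟩ :
        {g // P g})) := by
    intro x y h
    have := congrArg Subtype.val h
    exact Subtype.ext this
  calc Nat.card (N[ι]) ≤ Nat.card {g // P g} :=
        Nat.card_le_card_of_injective _ hinj
    _ = Fintype.card {g // P g} := Nat.card_eq_fintype_card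
    _ = (Finset.univ.filter P).card := Fintype.card_subtype P
    _ ≤ ((Finset.univ.filter fun g => Fr[σ] g = g) ∪
          (Finset.univ.filter fun g => Fr[σ] g = -g)).card := by
        apply Finset.card_le_card
        intro g hg
        simp only [hP, Finset.mem_filter, Finset.mem_union, Finset.mem_univ, true_and] at hg ⊢
        exact hg
    _ ≤ (Finset.univ.filter fun g => Fr[σ] g = g).card +
          (Finset.univ.filter fun g => Fr[σ] g = -g).card := Finset.card_union_le _ _
    _ ≤ Fintype.card (SL(2, k)) +
          Fintype.card (SL(2, k)) :=
        Nat.add_le_add (card_filter_frobSL_eq_le ι σ hσ) (card_filter_frobSL_eq_neg_le ι σ hσ)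
    _ = 2 * Fintype.card (SL(2, k)) := by ring

end Summit.MatrixMultiplication.MatrixMultiplication.Theorems.GradedDesignFamily.Negative
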